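import Literature.Analysis.FluidPDE.BoltzmannEquationProofs
import Mathlib.Analysis.SpecialFunctions.Gaussian.GaussianIntegral
import Mathlib.MeasureTheory.Integral.Prod
import Mathlib.MeasureTheory.Measure.Haar.NormedSpace
import HarnessLib

/-!
# The dispersive line bound of Illner–Shinbrot (rare gas cloud expanding in the vacuum)

Topic: MathematicalPhysics / KineticTheory. First layer of the existence half of the named fact
`Literature.MathematicalPhysics.KineticTheory.illner_pulvirenti` (global validity of the
Boltzmann equation for a rare gas cloud in all space; Cercignani–Illner–Pulvirenti 1994
Thm 4.5.1 and Thm 5.2.2 = Illner–Shinbrot 1984): the *dispersive* estimate that makes the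
perturbation-of-vacuum theory global in time.

Along the free characteristic `τ ↦ x + τ v` the collision frequency of a cloud dominated by the
travelling Maxwellian `e^{-(β/2)(|y - τ w|² + |w|²)}` is

  `D(x, v, τ) = ∫ |v - w| e^{-(β/2)(|x + τ v - τ w|² + |w|²)} dw`,

and the whole point (CIP 1994 §4.5, Step 3, (5.6)–(5.8); Illner–Shinbrot 1984 Lemma 2.1) is
that its time integral over `[0, ∞)` is bounded UNIFORMLY in `(x, v)`: the relative speed
`|v - w|` is exactly compensated by the time a straight line spends in a Gaussian,

  `|u| ∫_ℝ e^{-(β/2)|x + τ u|²} dτ ≤ (2π/β)^{1/2}`     (`norm_mul_setIntegral_exp_line_le`),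

whence, by Fubini,

  `∫_a^b D(x, v, τ) dτ ≤ (2π/β)^{1/2} ∫ e^{-(β/2)|w|²} dw`   (`intervalIntegral_dispersiveMajorant_le`).

Contents (theorems only, no definitions; velocity space a finite-dimensional real inner product
space `E`, as in Wave0):

* `sq_inner_div_norm_add_mul_le` — `(⟨x,u⟩/|u| + τ|u|)² ≤ |x + τu|²` (Cauchy–Schwarz);
* `integral_exp_neg_mul_sq_affine`, `integrable_exp_neg_mul_sq_affine` — the one-dimensional
  Gaussian with an affine argument, `∫ e^{-b(a + τc)²} dτ = (π/b)^{1/2}/|c|`;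
* `norm_mul_setIntegral_exp_line_le` — the line bound displayed above (any set of times);
* `integrable_dispersiveMajorant` — `(τ, w) ↦ |v - w| e^{-(β/2)(|x + τv - τw|² + |w|²)}` is
  integrable on `(a, b] × E`;
* `intervalIntegrable_dispersiveMajorant`, `dispersiveMajorant_nonneg`,
  `intervalIntegral_dispersiveMajorant_le` — the majorant `D(x, v, ·)` is interval integrable,
  nonnegative, and its time integral obeys the displayed uniform bound.

## References

* C. Cercignani, R. Illner, M. Pulvirenti, *The Mathematical Theory of Dilute Gases*, Applied
  Mathematical Sciences 106, Springer (1994), §4.5 (proof of Thm 4.5.1, Step 3, (5.6)–(5.8),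
  pp. 88–90) and Thm 5.2.2 p. 137.
* R. Illner, M. Shinbrot, *The Boltzmann equation: global existence for a rare gas in an
  infinite vacuum*, Comm. Math. Phys. 95 (1984) 217–226.
-/

open MeasureTheory Real Set Filter Topology
open scoped InnerProductSpace

namespace Literature.MathematicalPhysics.KineticTheory

noncomputable section

section LineBound

variable {E : Type*} [NormedAddCommGroup E] [InnerProductSpace ℝ E]

/-- The component of `x + τ u` along `u` is at most its length:
`(⟨x, u⟩/|u| + τ |u|)² ≤ |x + τ u|²` for `u ≠ 0` (Cauchy–Schwarz applied to
`⟨x + τu, u⟩ = ⟨x, u⟩ + τ|u|²`). [folklore] -/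
theorem sq_inner_div_norm_add_mul_le {u : E} (hu : u ≠ 0) (x : E) (τ : ℝ) :
    (⟪x, u⟫_ℝ / ‖u‖ + τ * ‖u‖) ^ 2 ≤ ‖x + τ • u‖ ^ 2 := by
  have hu0 : 0 < ‖u‖ := norm_pos_iff.2 hu
  have h1 : ⟪x, u⟫_ℝ / ‖u‖ + τ * ‖u‖ = ⟪x + τ • u, u⟫_ℝ / ‖u‖ := by
    rw [inner_add_left, real_inner_smul_left, real_inner_self_eq_norm_sq]
    field_simp
  have h2 : |⟪x + τ • u, u⟫_ℝ| ≤ ‖x + τ • u‖ * ‖u‖ := abs_real_inner_le_norm _ _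
  rw [h1, div_pow, div_le_iff₀ (by positivity), ← mul_pow, ← sq_abs]
  exact pow_le_pow_left₀ (abs_nonneg _) h2 2

/-- The one-dimensional Gaussian integral with an affine argument:
`∫_ℝ e^{-b (a + τ c)²} dτ = (π/b)^{1/2} / |c|` (substitution `s = a + τc` in Mathlib's
`integral_gaussian`; for `b ≤ 0` or `c = 0` both sides are the junk value `0`). [folklore] -/
theorem integral_exp_neg_mul_sq_affine (b c a : ℝ) :
    ∫ τ : ℝ, exp (-b * (a + τ * c) ^ 2) = √(π / b) / |c| := by
  have h1 : (∫ τ : ℝ, exp (-b * (a + τ * c) ^ 2)) =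
      |c⁻¹| • ∫ s : ℝ, exp (-b * (a + s) ^ 2) :=
    Measure.integral_comp_mul_right (fun s => exp (-b * (a + s) ^ 2)) c
  have h2 : (∫ s : ℝ, exp (-b * (a + s) ^ 2)) = ∫ s : ℝ, exp (-b * s ^ 2) := by
    have h := integral_add_right_eq_self (μ := (volume : Measure ℝ))
      (fun s => exp (-b * s ^ 2)) a
    simpa only [add_comm] using h
  rw [h1, h2, integral_gaussian, smul_eq_mul, abs_inv, inv_mul_eq_div]

/-- The affine Gaussian `τ ↦ e^{-b (a + τ c)²}` is integrable on `ℝ` for `b > 0`, `c ≠ 0`.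
[folklore] -/
theorem integrable_exp_neg_mul_sq_affine {b : ℝ} (hb : 0 < b) {c : ℝ} (hc : c ≠ 0) (a : ℝ) :
    Integrable fun τ : ℝ => exp (-b * (a + τ * c) ^ 2) := by
  have h1 : Integrable fun s : ℝ => exp (-b * (s + a) ^ 2) :=
    (integrable_exp_neg_mul_sq hb).comp_add_right a
  have h2 : Integrable fun τ : ℝ => exp (-b * (τ * c + a) ^ 2) := h1.comp_mul_right' hc
  refine h2.congr (Eventually.of_forall fun τ => ?_)
  simp only [add_comm]

/-- **The line bound** (CIP 1994 §4.5 (5.7); Illner–Shinbrot 1984 Lemma 2.1): the time a free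
trajectory of velocity `u` spends in a Gaussian is inversely proportional to its speed,
`|u| ∫_S e^{-(β/2)|x + τu|²} dτ ≤ (2π/β)^{1/2}` for every set of times `S`, uniformly in the
starting point `x` (for `u = 0` the left side vanishes). [cite: CIP1994, §4.5 (5.7)] -/
theorem norm_mul_setIntegral_exp_line_le {β : ℝ} (hβ : 0 < β) (x u : E) (S : Set ℝ) :
    ‖u‖ * ∫ τ in S, exp (-(β / 2) * ‖x + τ • u‖ ^ 2) ≤ √(2 * π / β) := by
  rcases eq_or_ne u 0 with rfl | hu
  · rw [norm_zero, zero_mul]; positivity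
  have hu0 : 0 < ‖u‖ := norm_pos_iff.2 hu
  set a : ℝ := ⟪x, u⟫_ℝ / ‖u‖ with ha
  set g : ℝ → ℝ := fun τ => exp (-(β / 2) * (a + τ * ‖u‖) ^ 2) with hg
  have hg_int : Integrable g := integrable_exp_neg_mul_sq_affine (half_pos hβ) hu0.ne' a
  have hfg : ∀ τ, exp (-(β / 2) * ‖x + τ • u‖ ^ 2) ≤ g τ := fun τ => by
    refine exp_le_exp.2 (mul_le_mul_of_nonpos_left (sq_inner_div_norm_add_mul_le hu x τ) ?_)
    linarith
  have h1 : ∫ τ in S, exp (-(β / 2) * ‖x + τ • u‖ ^ 2) ≤ ∫ τ, g τ :=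
    calc ∫ τ in S, exp (-(β / 2) * ‖x + τ • u‖ ^ 2) ≤ ∫ τ in S, g τ :=
          integral_mono_of_nonneg (Eventually.of_forall fun τ => (exp_pos _).le)
            hg_int.integrableOn (Eventually.of_forall hfg)
      _ ≤ ∫ τ, g τ := setIntegral_le_integral hg_int (Eventually.of_forall fun τ => (exp_pos _).le)
  have h2 : ∫ τ, g τ = √(2 * π / β) / ‖u‖ := by
    have h := integral_exp_neg_mul_sq_affine (β / 2) ‖u‖ a
    rw [abs_of_pos hu0] at h
    rw [hg, h]
    congr 2
    field_simp
  calc ‖u‖ * ∫ τ in S, exp (-(β / 2) * ‖x + τ • u‖ ^ 2) ≤ ‖u‖ * (√(2 * π / β) / ‖u‖) :=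
        mul_le_mul_of_nonneg_left (h1.trans h2.le) hu0.le
    _ = √(2 * π / β) := mul_div_cancel₀ _ hu0.ne'

end LineBound

/-! ## The dispersive collision-frequency majorant -/

section Majorant

variable {E : Type*} [NormedAddCommGroup E] [InnerProductSpace ℝ E] [FiniteDimensional ℝ E]
  [MeasurableSpace E] [BorelSpace E]

/-- The integrand `(τ, w) ↦ |v - w| e^{-(β/2)(|x + τv - τw|² + |w|²)}` of the dispersive
majorant is integrable on `(a, b] × E` (it is continuous and dominated by
`(1 + |v|)(1 + |w|) e^{-(β/2)|w|²}`, integrable in `w` by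
`Literature.Analysis.FluidPDE.integrable_one_add_norm_mul_exp`, times a finite measure in `τ`).
[folklore] -/
theorem integrable_dispersiveMajorant {β : ℝ} (hβ : 0 < β) (x v : E) (a b : ℝ) :
    Integrable (fun p : ℝ × E =>
        ‖v - p.2‖ * exp (-(β / 2) * (‖x + p.1 • v - p.1 • p.2‖ ^ 2 + ‖p.2‖ ^ 2)))
      ((volume.restrict (Ioc a b)).prod volume) := by
  set ψ : E → ℝ := fun w => (1 + ‖w‖) * exp (-(β / 2) * ‖w‖ ^ 2) with hψ
  have hψi : Integrable ψ := Literature.Analysis.FluidPDE.integrable_one_add_norm_mul_exp hβ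
  have hdom : Integrable (fun p : ℝ × E => (1 + ‖v‖) * ψ p.2)
      ((volume.restrict (Ioc a b)).prod volume) :=
    (hψi.const_mul (1 + ‖v‖)).comp_snd _
  refine hdom.mono' ?_ (Eventually.of_forall fun p => ?_)
  · exact (by fun_prop : Continuous fun p : ℝ × E =>
      ‖v - p.2‖ * exp (-(β / 2) * (‖x + p.1 • v - p.1 • p.2‖ ^ 2 + ‖p.2‖ ^ 2))).aestronglyMeasurable
  · rw [Real.norm_of_nonneg (by positivity)]
    have h1 : ‖v - p.2‖ ≤ (1 + ‖v‖) * (1 + ‖p.2‖) := by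
      have := norm_sub_le v p.2
      nlinarith [norm_nonneg v, norm_nonneg p.2]
    have h2 : exp (-(β / 2) * (‖x + p.1 • v - p.1 • p.2‖ ^ 2 + ‖p.2‖ ^ 2)) ≤
        exp (-(β / 2) * ‖p.2‖ ^ 2) := by
      refine exp_le_exp.2 ?_
      nlinarith [sq_nonneg ‖x + p.1 • v - p.1 • p.2‖]
    calc ‖v - p.2‖ * exp (-(β / 2) * (‖x + p.1 • v - p.1 • p.2‖ ^ 2 + ‖p.2‖ ^ 2))
        ≤ ((1 + ‖v‖) * (1 + ‖p.2‖)) * exp (-(β / 2) * ‖p.2‖ ^ 2) :=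
          mul_le_mul h1 h2 (exp_pos _).le (by positivity)
      _ = (1 + ‖v‖) * ψ p.2 := by simp only [hψ]; ring

/-- The dispersive majorant `D(x, v, τ) = ∫ |v - w| e^{-(β/2)(|x + τv - τw|² + |w|²)} dw` is
interval integrable in `τ` (Fubini, from `integrable_dispersiveMajorant`). [folklore] -/
theorem intervalIntegrable_dispersiveMajorant {β : ℝ} (hβ : 0 < β) (x v : E) (a b : ℝ) :
    IntervalIntegrable (fun τ : ℝ =>
        ∫ w, ‖v - w‖ * exp (-(β / 2) * (‖x + τ • v - τ • w‖ ^ 2 + ‖w‖ ^ 2))) volume a b := by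
  rcases le_total a b with hab | hab
  · rw [intervalIntegrable_iff_integrableOn_Ioc_of_le hab]
    exact (integrable_dispersiveMajorant hβ x v a b).integral_prod_left
  · refine IntervalIntegrable.symm ?_
    rw [intervalIntegrable_iff_integrableOn_Ioc_of_le hab]
    exact (integrable_dispersiveMajorant hβ x v b a).integral_prod_left

/-- The dispersive majorant is nonnegative. [folklore] -/
theorem dispersiveMajorant_nonneg (β : ℝ) (x v : E) (τ : ℝ) :
    0 ≤ ∫ w, ‖v - w‖ * exp (-(β / 2) * (‖x + τ • v - τ • w‖ ^ 2 + ‖w‖ ^ 2)) :=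
  integral_nonneg fun w => by positivity

/-- **The dispersive bound of Illner–Shinbrot** (CIP 1994 §4.5, Step 3 of the proof of
Thm 4.5.1, (5.6)–(5.8), pp. 88–90; Illner–Shinbrot 1984 Lemma 2.1). Uniformly in the
characteristic `(x, v)` and in the time interval `a ≤ b`,
`∫_a^b ∫ |v - w| e^{-(β/2)(|x + τv - τw|² + |w|²)} dw dτ ≤ (2π/β)^{1/2} ∫ e^{-(β/2)|w|²} dw`:
Fubini, then for each `w` the line bound `norm_mul_setIntegral_exp_line_le` with `u = v - w`.
This finiteness of the total collision frequency along free trajectories is what makes the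
rare-cloud theory global in time. [cite: CIP1994, §4.5 (5.6)–(5.8)] -/
theorem intervalIntegral_dispersiveMajorant_le {β : ℝ} (hβ : 0 < β) (x v : E) {a b : ℝ}
    (hab : a ≤ b) :
    ∫ τ in a..b, (∫ w, ‖v - w‖ * exp (-(β / 2) * (‖x + τ • v - τ • w‖ ^ 2 + ‖w‖ ^ 2))) ≤
      √(2 * π / β) * ∫ w : E, exp (-(β / 2) * ‖w‖ ^ 2) := by
  have hG := integrable_dispersiveMajorant hβ x v a b
  rw [intervalIntegral.integral_of_le hab,
    integral_integral_swap (f := fun (τ : ℝ) (w : E) =>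
      ‖v - w‖ * exp (-(β / 2) * (‖x + τ • v - τ • w‖ ^ 2 + ‖w‖ ^ 2))) hG,
    ← integral_const_mul]
  have hgauss : Integrable fun w : E => exp (-(β / 2) * ‖w‖ ^ 2) :=
    Literature.Analysis.FluidPDE.integrable_exp_neg_mul_sq_norm (half_pos hβ)
  refine integral_mono_of_nonneg (Eventually.of_forall fun w => ?_) (hgauss.const_mul _)
    (Eventually.of_forall fun w => ?_)
  · exact integral_nonneg fun τ => by positivity
  · -- the line bound at fixed `w`, with `u = v - w`
    dsimp only
    have hsplit : ∀ τ : ℝ, ‖v - w‖ * exp (-(β / 2) * (‖x + τ • v - τ • w‖ ^ 2 + ‖w‖ ^ 2)) =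
        (‖v - w‖ * exp (-(β / 2) * ‖x + τ • (v - w)‖ ^ 2)) * exp (-(β / 2) * ‖w‖ ^ 2) :=
      fun τ => by
      rw [smul_sub, add_sub_assoc', mul_add, exp_add, mul_assoc]
    simp_rw [hsplit]
    rw [integral_mul_const, integral_const_mul]
    exact mul_le_mul_of_nonneg_right (norm_mul_setIntegral_exp_line_le hβ x (v - w) (Ioc a b))
      (exp_pos _).le

end Majorant

end

end Literature.MathematicalPhysics.KineticTheory
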